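import Literature.MathematicalPhysics.QuantumFieldTheory.Balaban1983to89.B13OpsYPencilXQuadGen
import Literature.MathematicalPhysics.QuantumFieldTheory.Balaban1983to89.B13GreenPrimeSymLettersOfReg335

/-!
# `Balaban1983to89.B13OpsYPencilRProjSym` — T. Bałaban, *Propagators for lattice gauge theories in a background field*, Commun. Math. Phys. **99** (1985)
389–434 [Balaban1985BackgroundPropagators], (3.19)–(3.21) pp. 393–394 (`Q′(U)`), (3.24)–(3.25) pp. 394–395 («R(U) = I − G′(U)Q′*(U)(Q′(U)G′(U)²Q′*(U))⁻¹Q′(U)G′(U)»),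
(3.35) p. 396, Thm 3.1 (3.42) p. 397, Thm 3.2 (3.48) p. 398, Thm 3.4 p. 400, Sect. B (3.66)–(3.68) p. 403, (3.69)–(3.70) p. 404, (3.71)–(3.72) p. 405 («R(U′U) … analytic functions of A′»), Thm 3.10 (3.107)–(3.108)
p. 416; *Renormalization group approach to lattice gauge field theories. II*, Commun. Math. Phys. **116** (1988) 1–22 [Balaban1988RG2Cluster] (2.5)–(2.7) pp. 12–13, p. 15:
THE R-STATION AT def-Y's v4 SITE TRANSPORTER `parSymY` (N06's record face), AND ON THE (3.35) CLASS WITH THE G′-FACTOR SUPPLIED BY NAME.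

n10-w2 g2's R-station (`B13OpsYPencilRProj` §3, transporter-generic) displays four transporter facts (`hQh hQhi` holomorphy of `A′ ↦ qpT i parS (e^{iηA′}U₀) s z` and
of its inverse; `hQf hQb hQsf hQsb` ONE numeral `KQ` on the supports of `qpK ∕ qpsK`); its §4 discharged them at the v2 letter `parSY` by module 73.  §1 here is the
v4 twin — the facts at `parS := parSymY i` are the lane's module 78 §1 (`qpT i (parSymY i) U s z = parSymY U (corner s) z` by `rfl`, `KQ = Kη^D`), exactly as
`B13OpsYPencilXQuadGen.rawEntryLetters_toMatrix_XinvY_parSymY_prodCfg_of_pencil` did for the X⁻¹-junction.  §2 feeds the G′ input BY NAME on the (3.35) class: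
dag-n10-c g15's `B13GreenPrimeSymLettersOfReg335.rawEntryLetters_toMatrix_GpY_parSymY_prodCfg_of_reg335` (module 79: invertibility and Theorem 3.1 at the centre are
N06's TREE theorems), so that the R-station's remaining displayed analytic input is the X⁻¹-junction's output alone.
* §1 ★★ `rawEntryLetters_toMatrix_RY_parSymY_prodCfg` — THE R-STATION AT `parSymY` (any `G′`-letter `Gp`, any complete normed algebra `𝔸`, any basis): `R(e^{iηA′}U₀)`
  along the pencil from `G′`'s and X⁻¹'s pencil letters (displayed — the junction outputs), the background's size `K₀`, the `Q′`-support numeral `D`, the kernel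
  row ∕ column sums `CQsr, CQc`, readings `ℓS, ℓB` with range numeral `r`, a fibre bound `m_S`, `0 < μ`, `2μ ≤ ρ`:
  `RawEntryLetters (A′ ↦ toMatrix (R(e^{iηA′}U₀))) (ℓS ∘ fst) R (ρ − 2μ) (1 + B_G′·(B_N·B_G′·M)·M)`, `B_N = (CQsr·|κ|·cb·Kη^{2D}·cl)(CQc·|κ|·cb·Kη^{2D}·cl)·B_X·e^{2ρr}`,
  `M = m_S·c₀(1,μ)^ν`, `Kη = K₀e^{|η|R}`.
* §2 ★★★ `rawEntryLetters_toMatrix_RY_parSymY_prodCfg_of_reg335` — for EVERY `U₀ ∈ (bg9K (M_N ℂ) G i).Reg335 c α₀` (`G ≤ U(N)`, `0 ≤ c·M·α₀`, `c·M·α₀·(d+1) ≤ 1∕16`) at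
  the letters of record `parSymY ∕ GpY i (parSymY i)`: §1 with `hG` := module 79's G′ letters (radius `R₁⋆`, rate `ρ′ < δ₀κ`, constant `2·cb·cl·16(L^k)²√N`; `K₀ = 1` by
  unitarity) at ANY radius `0 < R′ ≤ R₁⋆` (the located inequality displayed ONCE) — what stays displayed: NODE 00's numerals (79's `D, Cavg, s, κ`; the station's
  `D_Q, CQsr, CQc, r`), the readings `ℓ′` (sites) and `ℓB` (blocks), a fibre bound, and the X⁻¹-junction's output `hXi` at `(R′, ρ′)` (hence — by
  `B13OpsYPencilXQuadGen` §4 at v4, `B13XinvCentreDecayOfUnitary`, `B13XinvCentreDecayOfReg335` — ultimately only the entry decay of `X(U₀)` on (3.35));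
  `…_of_reg335_record` (matrix units, `cb = cl = 1`).
HONEST FRAMING: compositions over cited tree theorems (78 §1, 79 §2, `B13OpsYPencilRProj` §3, `rawEntryLetters_mono`); NODE 00's `RY ∕ qpT ∕ qpK ∕ qpsK ∕ parSymY ∕ GpY ∕
XinvY`, pv27's `prodCfg` CONSUMED BY NAME, nothing of `Node00/OpsY*` modified; the X⁻¹ letters stay a displayed hypothesis (they carry Thm 3.2 at `U₀`); Theorem 3.1 for
`G′` on (3.35) is N06's tree theorem via 79, not re-proved; nothing of Bałaban's asserted beyond the cited theorems; N06 ∕ N10 NOT discharged; K1⁷ NOT closed; counts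
unmoved (typed 28∕28 · discharged 5∕27); THEOREMS ONLY, 0 `sorry`, standard axioms; one finite 𝕋⁴ programme at fixed ε — R4 closes the conditional finite-𝕋⁴ rung
`BalabanLadder.UV` only; the YM mass gap (Clay) is NOT proved by any of this; nothing continuum ∕ ℝ⁴ ∕ OS.

References: T. Bałaban, CMP 99 (1985) 389–434 [Balaban1985BackgroundPropagators] (3.19)–(3.21) pp.393–394, (3.24)–(3.25) pp.394–395, (3.35) p.396, Thm 3.1 (3.42)
p.397, Thm 3.2 (3.48) p.398, Thm 3.4 p.400, (3.60)–(3.65) p.402, (3.66)–(3.68) p.403, (3.69)–(3.70) p.404, (3.71)–(3.72) p.405, Thm 3.10 (3.107)–(3.108) pp.415–416; CMP 116 (1988) 1–22 [Balaban1988RG2Cluster]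
(2.5)–(2.7) pp.12–13, p.15; CMP 96 (1984) 223–250 [Balaban1984PropagatorsII] (2.54) p.232, Lemma 2.1 (2.61) p.234.
DOC-ONLY EDITION (dag-n10-w2 g4, 2026-08-28): [B9] page locators corrected per the page owner lit-balaban-r06 — (3.25) p.394; (3.48) p.398; (3.60)–(3.65) p.402,
(3.66)–(3.68) p.403, (3.69)–(3.70) p.404, (3.71)–(3.72) p.405; (3.84)–(3.86) p.407 only; every declaration byte-identical to the previous edition.
-/

noncomputable section

namespace Literature.MathematicalPhysics.QuantumFieldTheory.Balaban1983to89.B13OpsYPencilRProjSym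

open Metric Set Finset Module
open scoped Matrix
open Literature.MathematicalPhysics.QuantumFieldTheory.Balaban1983to89
open Literature.MathematicalPhysics.QuantumFieldTheory.Balaban1983to89.B9Thm37GlueTorus (tdist1)
open Literature.MathematicalPhysics.QuantumFieldTheory.Balaban1983to89.B5TorusCover (UT)
open Literature.MathematicalPhysics.QuantumFieldTheory.Balaban1983to89.B4TorusKernel.MultiPeriod (torusSupNorm)
open Literature.MathematicalPhysics.QuantumFieldTheory.Balaban1983to89.B13EntrywiseWalks (RawEntryLetters)
open Literature.MathematicalPhysics.QuantumFieldTheory.Balaban1983to89.B13EntryLetterAlgebra (rawEntryLetters_mono)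
open Literature.MathematicalPhysics.QuantumFieldTheory.Balaban1983to89.B13OpsYPencilRProj (rawEntryLetters_toMatrix_RY_prodCfg)
open Literature.MathematicalPhysics.QuantumFieldTheory.Balaban1983to89.B13OpsYPencilGreenPrimeSym
  (differentiableOn_parSymY_prodCfg differentiableOn_parSymY_inv_prodCfg norm_parSymY_prodCfg_le norm_parSymY_inv_prodCfg_le)
open Literature.MathematicalPhysics.QuantumFieldTheory.Balaban1983to89.B13GreenPrimeSymLettersOfReg335
  (norm_unit_le_one_of_mem rawEntryLetters_toMatrix_GpY_parSymY_prodCfg_of_reg335)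
open Literature.MathematicalPhysics.QuantumFieldTheory.Balaban1983to89.B13MatrixUnitBasisNumerals (norm_stdBasis_repr_le norm_stdBasis_le_one)
open Literature.MathematicalPhysics.QuantumFieldTheory.Balaban1983to89.B9Eq39Adjoint (prodCfg)
open Literature.MathematicalPhysics.QuantumFieldTheory.Balaban1983to89.B6GlobalChartV1 (PV boxEquiv)
open Literature.MathematicalPhysics.QuantumFieldTheory.Balaban1983to89.B6KLevelCensusIndexV1 (KIdx kGeo)
open Literature.MathematicalPhysics.QuantumFieldTheory.Balaban1983to89.B9BackgroundsKLevelV1 (bg9K)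
open Literature.MathematicalPhysics.QuantumFieldTheory.Balaban1983to89.Node00

/-! ## §1. ★★ The R-station at def-Y's v4 letter `parSymY` (transporter facts by the lane's module 78 §1) -/

section ParSymY

variable {𝔸 : Type} [NormedRing 𝔸] [NormedAlgebra ℂ 𝔸] [CompleteSpace 𝔸] [NormOneClass 𝔸]
variable {d ℓ : ℕ} {hd : 1 ≤ d + 1} {hL : Odd (ℓ + 1) ∧ 1 < ℓ + 1} {b₀ b₁ : ℝ}
variable (i : KIdx d ℓ hd hL b₀ b₁)
variable {κ : Type} [Fintype κ] [DecidableEq κ] (b : Basis κ ℂ 𝔸)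
variable (U₀ : CfgY 𝔸 i) (η : ℝ) {Rc : ℝ}
variable [DecidableEq (SiteY i)] [DecidableEq (BlkY i)]
variable {ν : ℕ} {Nf : Fin ν → ℕ} [∀ j, NeZero (Nf j)]

/-- ★★ **THE R-STATION AT def-Y's v4 LETTER `parSymY`** (any `G′`-letter `Gp`): `B13OpsYPencilRProj.rawEntryLetters_toMatrix_RY_prodCfg` with §1's four transporter
facts discharged by the lane's module 78 §1 (`differentiableOn_parSymY(_inv)_prodCfg`, `norm_parSymY(_inv)_prodCfg_le`; `qpT i (parSymY i) U s z = parSymY U (corner s) z`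
by `rfl`) — `KQ = Kη^D` from the background's size `‖U₀(b)^{±1}‖ ≤ K₀`, `1 ≤ K₀` and the `Q′`-support numeral `D` (`qpK(s,z) ≠ 0 ∨ qpsK(z,s) ≠ 0 ⇒
tdist(chart⁻¹(corner s), chart⁻¹ z) ≤ D`).  DISPLAYED: `G′`'s pencil letters `(R, ρ, B_G′)` on sites and X⁻¹'s pencil letters `(R, ρ, B_X)` on blocks (the junction
outputs), the kernel numerals `CQsr, CQc`, readings `ℓS ℓB` with `r`, a fibre bound `m_S`, `0 < μ`, `2μ ≤ ρ`.
[cite: Balaban1985BackgroundPropagators, (3.19)–(3.21) pp.393–394, (3.25) p.394, Thm 3.4 p.400, (3.66)–(3.68) p.403, (3.69)–(3.70) p.404, (3.71)–(3.72) p.405, Thm 3.10 (3.108) p.416; Balaban1988RG2Cluster, (2.5)–(2.7) pp.12–13] -/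
theorem rawEntryLetters_toMatrix_RY_parSymY_prodCfg (Gp : SiteOpY 𝔸 i) {K₀ : ℝ} {D : ℕ}
    (hU : ∀ μ x, ‖(U₀ μ x : 𝔸)‖ ≤ K₀) (hUi : ∀ μ x, ‖(((U₀ μ x)⁻¹ : 𝔸ˣ) : 𝔸)‖ ≤ K₀) (hK1 : 1 ≤ K₀) (hR0 : 0 ≤ Rc)
    (hD : ∀ s z, qpK i s z ≠ 0 → Site.tdist ((boxEquiv i.hN).symm (blkCornerY i s)) ((boxEquiv i.hN).symm z) ≤ D)
    (hDs : ∀ z s, qpsK i z s ≠ 0 → Site.tdist ((boxEquiv i.hN).symm (blkCornerY i s)) ((boxEquiv i.hN).symm z) ≤ D)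
    {cb cl : ℝ} (hcb : ∀ (x : 𝔸) (k : κ), ‖b.repr x k‖ ≤ cb * ‖x‖) (hcb0 : 0 ≤ cb) (hcl : ∀ l, ‖b l‖ ≤ cl) (hcl0 : 0 ≤ cl)
    {CQsr CQc : ℝ} (hCQsr0 : 0 ≤ CQsr) (hCQsr : ∀ z, ∑ s, |qpsK i z s| ≤ CQsr) (hCQc0 : 0 ≤ CQc) (hCQc : ∀ z, ∑ s, |qpK i s z| ≤ CQc)
    (ℓS : SiteY i → UT Nf) (ℓB : BlkY i → UT Nf) {r : ℝ}
    (hℓQ : ∀ s z, qpK i s z ≠ 0 → tdist1 Nf (ℓB s) (ℓS z) ≤ r) (hℓQs : ∀ z s, qpsK i z s ≠ 0 → tdist1 Nf (ℓS z) (ℓB s) ≤ r)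
    {mS : ℕ} (hfibS : ∀ y : UT Nf, (univ.filter fun q : SiteY i × κ => ℓS q.1 = y).card ≤ mS)
    {ρ BG BX μ : ℝ} (hρ : 0 ≤ ρ)
    (hG : RawEntryLetters (fun a : Fin (d + 1) → Site (PV d ℓ i.m i.K hd hL) 0 → 𝔸 =>
      LinearMap.toMatrix ((Pi.basis fun _ : SiteY i => b).reindex (Equiv.sigmaEquivProd (SiteY i) κ))
        ((Pi.basis fun _ : SiteY i => b).reindex (Equiv.sigmaEquivProd (SiteY i) κ)) (Gp (prodCfg U₀ η a)))
      (fun q : SiteY i × κ => ℓS q.1) Rc ρ BG)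
    (hXi : RawEntryLetters (fun a : Fin (d + 1) → Site (PV d ℓ i.m i.K hd hL) 0 → 𝔸 =>
      LinearMap.toMatrix ((Pi.basis fun _ : BlkY i => b).reindex (Equiv.sigmaEquivProd (BlkY i) κ))
        ((Pi.basis fun _ : BlkY i => b).reindex (Equiv.sigmaEquivProd (BlkY i) κ)) (XinvY i (parSymY i) Gp (prodCfg U₀ η a)))
      (fun p : BlkY i × κ => ℓB p.1) Rc ρ BX)
    (hμ : 0 < μ) (h2μ : 2 * μ ≤ ρ) :
    RawEntryLetters (fun a : Fin (d + 1) → Site (PV d ℓ i.m i.K hd hL) 0 → 𝔸 =>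
        LinearMap.toMatrix ((Pi.basis fun _ : SiteY i => b).reindex (Equiv.sigmaEquivProd (SiteY i) κ))
          ((Pi.basis fun _ : SiteY i => b).reindex (Equiv.sigmaEquivProd (SiteY i) κ)) (RY i (parSymY i) Gp (prodCfg U₀ η a)))
      (fun q : SiteY i × κ => ℓS q.1) Rc (ρ - 2 * μ)
      (1 + BG * (CQsr * (Fintype.card κ : ℝ) * (cb * ((K₀ * Real.exp (|η| * Rc)) ^ D * cl * (K₀ * Real.exp (|η| * Rc)) ^ D)) *
            (CQc * (Fintype.card κ : ℝ) * (cb * ((K₀ * Real.exp (|η| * Rc)) ^ D * cl * (K₀ * Real.exp (|η| * Rc)) ^ D))) * BX *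
            Real.exp (2 * ρ * r) * BG * (mS * B6.c0 1 μ ^ ν)) * (mS * B6.c0 1 μ ^ ν)) := by
  have h1 : (1 : ℝ) ≤ K₀ * Real.exp (|η| * Rc) := one_le_mul_of_one_le_of_one_le hK1 (Real.one_le_exp (mul_nonneg (abs_nonneg _) hR0))
  have hKQ : 0 ≤ (K₀ * Real.exp (|η| * Rc)) ^ D := pow_nonneg (zero_le_one.trans h1) D
  exact rawEntryLetters_toMatrix_RY_prodCfg i b (parSymY i) U₀ η Gp hcb hcb0 hcl hcl0 hKQ
    (fun s z => differentiableOn_parSymY_prodCfg i U₀ η (blkCornerY i s) z) (fun s z => differentiableOn_parSymY_inv_prodCfg i U₀ η (blkCornerY i s) z)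
    (fun a ha s z hM => (norm_parSymY_prodCfg_le i U₀ η hU hUi hR0 ha (blkCornerY i s) z).trans (pow_le_pow_right₀ h1 (hD s z hM)))
    (fun a ha s z hM => (norm_parSymY_inv_prodCfg_le i U₀ η hU hUi hR0 ha (blkCornerY i s) z).trans (pow_le_pow_right₀ h1 (hD s z hM)))
    (fun a ha z s hM => (norm_parSymY_inv_prodCfg_le i U₀ η hU hUi hR0 ha (blkCornerY i s) z).trans (pow_le_pow_right₀ h1 (hDs z s hM)))
    (fun a ha z s hM => (norm_parSymY_prodCfg_le i U₀ η hU hUi hR0 ha (blkCornerY i s) z).trans (pow_le_pow_right₀ h1 (hDs z s hM)))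
    hCQsr0 hCQsr hCQc0 hCQc ℓS ℓB hℓQ hℓQs hfibS hρ hG hXi hμ h2μ

end ParSymY

/-! ## §2. ★★★ On the (3.35) class at the letters of record: the G′ input supplied BY NAME (module 79) -/

section Reg335

open scoped Matrix.Norms.L2Operator

variable {d ℓ : ℕ} {hd : 1 ≤ d + 1} {hL : Odd (ℓ + 1) ∧ 1 < ℓ + 1} {b₀ b₁ : ℝ}
variable (i : KIdx d ℓ hd hL b₀ b₁) {N : ℕ} [NeZero N] {G : Subgroup (Matrix (Fin N) (Fin N) ℂ)ˣ}
variable {κ : Type} [Fintype κ] [DecidableEq κ] (b : Basis κ ℂ (Matrix (Fin N) (Fin N) ℂ))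
variable {ν : ℕ} {Nf : Fin ν → ℕ} [∀ j, NeZero (Nf j)]

/-- ★★★ **THE R-STATION ON THE (3.35) CLASS, G′ BY NAME.**  For EVERY background `U₀ ∈ (bg9K (M_N ℂ) G i).Reg335 c α₀` (`G ≤ U(N)`, `0 ≤ c·M·α₀`, `c·M·α₀·(d+1) ≤ 1∕16`)
at the letters of record `parSymY`, `G′ = GpY i (parSymY i)`: §1 with its G′ input := module 79's `rawEntryLetters_toMatrix_GpY_parSymY_prodCfg_of_reg335` (Theorem 3.1 at
the centre and invertibility of `Δ′_a(U₀)` are N06's TREE theorems; `K₀ = 1` by unitarity), read at ANY radius `0 < R′ ≤ R₁⋆` (79's located thin radius — the inequality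
`hR′` is the only place its formula appears) and the same rate `ρ′ < δ₀κ`.  DISPLAYED: 79's numerals (`D`, `Cavg`, reading `ℓ′` with `s`, `κ`, fibre bound `m`), the
station's numerals (`Q′`-support `D_Q`, row ∕ column sums `CQsr, CQc`, block reading `ℓB` with range `r`), the basis numerals, and the X⁻¹-JUNCTION's OUTPUT
`hXi : RawEntryLetters (A′ ↦ toMatrix (X⁻¹(e^{iηA′}U₀))) (ℓB ∘ fst) R′ ρ_X B_X` at any rate `0 ≤ ρ_X ≤ ρ′` (Thm 3.2's content — `B13OpsYPencilXQuadGen` §4 at v4 with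
`B13XinvCentreDecayOf{Unitary,Reg335}`; G′'s letters are lowered to `ρ_X` by `rawEntryLetters_mono`); `0 < μ`, `2μ ≤ ρ_X`.  Conclusion:
`RawEntryLetters (A′ ↦ toMatrix (R(e^{iηA′}U₀))) (ℓ′ ∘ fst) R′ (ρ_X − 2μ) (1 + B_G′·(B_N·B_G′·M)·M)` with `B_G′ = 2·cb·cl·16(L^k)²√N`,
`B_N = (CQsr·|κ|·cb·e^{2|η|R′D_Q}·cl)(CQc·|κ|·cb·e^{2|η|R′D_Q}·cl)·B_X·e^{2ρ_X r}`, `M = m·c₀(1,μ)^ν`.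
[cite: Balaban1985BackgroundPropagators, (3.19)–(3.21) pp.393–394, (3.24)–(3.25) pp.394–395, (3.35) p.396, Thm 3.1 (3.42) p.397, Thm 3.2 (3.48) p.398, Thm 3.4 p.400,
(3.60)–(3.65) p.402, (3.66)–(3.68) p.403, (3.69)–(3.70) p.404, (3.71)–(3.72) p.405, Thm 3.10 (3.107)–(3.108) p.416; Balaban1988RG2Cluster, (2.5)–(2.7) pp.12–13, p.15; Balaban1984PropagatorsII, Lemma 2.1 (2.61) p.234] -/
theorem rawEntryLetters_toMatrix_RY_parSymY_prodCfg_of_reg335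
    (hG : G ≤ B7Prop2Explicit.unitaryUnits (Matrix (Fin N) (Fin N) ℂ))
    {U₀ : CfgY (Matrix (Fin N) (Fin N) ℂ) i} {c α₀ : ℝ} (hC0 : 0 ≤ c * (kGeo i).M * α₀) (hC1 : c * (kGeo i).M * α₀ * ((d : ℝ) + 1) ≤ 1 / 16)
    (hreg : (bg9K (Matrix (Fin N) (Fin N) ℂ) G i).Reg335 c α₀ U₀)
    (η : ℝ) {Rc : ℝ} (hRc : 0 < Rc) {D : ℕ}
    (hD : ∀ z w, avgCoeffY i z w ≠ 0 →
      Site.tdist ((boxEquiv i.hN).symm z) ((boxEquiv i.hN).symm (cornerY i (levY i z) z)) +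
        Site.tdist ((boxEquiv i.hN).symm (cornerY i (levY i z) z)) ((boxEquiv i.hN).symm w) ≤ D)
    {Cavg : ℝ} (hCavg0 : 0 ≤ Cavg) (hCavg : ∀ z, ∑ w, |avgCoeffY i z w| ≤ Cavg)
    {cb cl : ℝ} (hcb : ∀ (a : Matrix (Fin N) (Fin N) ℂ) (k : κ), ‖b.repr a k‖ ≤ cb * ‖a‖) (hcb0 : 0 ≤ cb) (hcl : ∀ l, ‖b l‖ ≤ cl) (hcl0 : 0 ≤ cl)
    (ℓ' : SiteY i → UT Nf) {s : ℝ} (hs0 : 0 ≤ s)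
    (hℓ : ∀ μ z, tdist1 Nf (ℓ' (shiftY i μ z)) (ℓ' z) ≤ s) (hℓa : ∀ z w, avgCoeffY i z w ≠ 0 → tdist1 Nf (ℓ' z) (ℓ' w) ≤ s)
    {κr : ℝ} (hκ0 : 0 ≤ κr)
    (hκ : ∀ z w : SiteY i, κr * tdist1 Nf (ℓ' z) (ℓ' w) ≤ ((((ℓ + 1) ^ i.k : ℕ) : ℝ))⁻¹ * torusSupNorm (toKT i).NB (z.1 - w.1))
    {m : ℕ} (hfib : ∀ y : UT Nf, (univ.filter fun p : SiteY i × κ => ℓ' p.1 = y).card ≤ m)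
    {ρ' : ℝ} (hρ'0 : 0 ≤ ρ') (hρ' : ρ' < (1 / (4 * ((d : ℝ) + 2))) * κr)
    -- the radius at which the R-station is read: any `0 < R′ ≤ R₁⋆` (79's located thin radius)
    {R' : ℝ} (hR'0 : 0 < R')
    (hR' : R' ≤ Rc / (4 * ((cb * (((d : ℝ) + 1) *
          (1 * Real.exp (|η| * Rc) * (1 * Real.exp (|η| * Rc) * cl * (1 * Real.exp (|η| * Rc)) + cl) * (1 * Real.exp (|η| * Rc)) +
            (1 * Real.exp (|η| * Rc) * cl * (1 * Real.exp (|η| * Rc)) + cl)) +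
          Cavg * ((1 * Real.exp (|η| * Rc)) ^ D * cl * (1 * Real.exp (|η| * Rc)) ^ D)) * Real.exp ((1 / (4 * ((d : ℝ) + 2)) * κr) * s)) *
          (cb * cl * (16 * ((((ℓ + 1) ^ i.k : ℕ) : ℝ)) ^ 2 * Real.sqrt N)) *
          (m * B6.c0 1 (((1 / (4 * ((d : ℝ) + 2))) * κr - ρ') / 3) ^ ν) * (m * B6.c0 1 (((1 / (4 * ((d : ℝ) + 2))) * κr - ρ') / 3) ^ ν)) + 1))
    -- the station's own numerals: `Q′`-support, kernel row ∕ column sums, block reading with range `r`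
    {DQ : ℕ}
    (hDQ : ∀ s z, qpK i s z ≠ 0 → Site.tdist ((boxEquiv i.hN).symm (blkCornerY i s)) ((boxEquiv i.hN).symm z) ≤ DQ)
    (hDQs : ∀ z s, qpsK i z s ≠ 0 → Site.tdist ((boxEquiv i.hN).symm (blkCornerY i s)) ((boxEquiv i.hN).symm z) ≤ DQ)
    {CQsr CQc : ℝ} (hCQsr0 : 0 ≤ CQsr) (hCQsr : ∀ z, ∑ s, |qpsK i z s| ≤ CQsr) (hCQc0 : 0 ≤ CQc) (hCQc : ∀ z, ∑ s, |qpK i s z| ≤ CQc)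
    (ℓB : BlkY i → UT Nf) {r : ℝ}
    (hℓQ : ∀ s z, qpK i s z ≠ 0 → tdist1 Nf (ℓB s) (ℓ' z) ≤ r) (hℓQs : ∀ z s, qpsK i z s ≠ 0 → tdist1 Nf (ℓ' z) (ℓB s) ≤ r)
    -- the X⁻¹-junction's output at `(R′, ρ_X)` for any rate `0 ≤ ρ_X ≤ ρ′` (Thm 3.2's content; displayed)
    {ρX BX μ : ℝ} (hρX0 : 0 ≤ ρX) (hρX : ρX ≤ ρ')
    (hXi : RawEntryLetters (fun a : Fin (d + 1) → Site (PV d ℓ i.m i.K hd hL) 0 → Matrix (Fin N) (Fin N) ℂ =>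
      LinearMap.toMatrix ((Pi.basis fun _ : BlkY i => b).reindex (Equiv.sigmaEquivProd (BlkY i) κ))
        ((Pi.basis fun _ : BlkY i => b).reindex (Equiv.sigmaEquivProd (BlkY i) κ))
        (XinvY i (parSymY i) (GpY i (parSymY i)) (prodCfg U₀ η a)))
      (fun p : BlkY i × κ => ℓB p.1) R' ρX BX)
    (hμ : 0 < μ) (h2μ : 2 * μ ≤ ρX) :
    RawEntryLetters (fun a : Fin (d + 1) → Site (PV d ℓ i.m i.K hd hL) 0 → Matrix (Fin N) (Fin N) ℂ =>
        LinearMap.toMatrix ((Pi.basis fun _ : SiteY i => b).reindex (Equiv.sigmaEquivProd (SiteY i) κ))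
          ((Pi.basis fun _ : SiteY i => b).reindex (Equiv.sigmaEquivProd (SiteY i) κ)) (RY i (parSymY i) (GpY i (parSymY i)) (prodCfg U₀ η a)))
      (fun q : SiteY i × κ => ℓ' q.1) R' (ρX - 2 * μ)
      (1 + 2 * (cb * cl * (16 * ((((ℓ + 1) ^ i.k : ℕ) : ℝ)) ^ 2 * Real.sqrt N)) *
          (CQsr * (Fintype.card κ : ℝ) * (cb * ((1 * Real.exp (|η| * R')) ^ DQ * cl * (1 * Real.exp (|η| * R')) ^ DQ)) *
            (CQc * (Fintype.card κ : ℝ) * (cb * ((1 * Real.exp (|η| * R')) ^ DQ * cl * (1 * Real.exp (|η| * R')) ^ DQ))) * BX *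
            Real.exp (2 * ρX * r) * (2 * (cb * cl * (16 * ((((ℓ + 1) ^ i.k : ℕ) : ℝ)) ^ 2 * Real.sqrt N))) * (m * B6.c0 1 μ ^ ν)) *
          (m * B6.c0 1 μ ^ ν)) := by
  -- the pencil's size numeral `K₀ = 1` on a `G`-valued background, `G ≤ U(N)`
  obtain ⟨hU, hUi⟩ := norm_unit_le_one_of_mem i hG hreg.1
  -- G′ along the pencil on (3.35), BY NAME (module 79), restricted to the radius `R′ ≤ R₁⋆` and the rate `ρ_X ≤ ρ′`
  have hGp := rawEntryLetters_toMatrix_GpY_parSymY_prodCfg_of_reg335 i b hG hC0 hC1 hreg η hRc hD hCavg0 hCavg hcb hcb0 hcl hcl0 ℓ' hs0 hℓ hℓa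
    hκ0 hκ hfib hρ'0 hρ'
  have hGp' := rawEntryLetters_mono hGp hR' hρX le_rfl
  -- the R-station at `parSymY` (§1) at radius `R′`, rate `ρ_X`
  exact rawEntryLetters_toMatrix_RY_parSymY_prodCfg i b U₀ η (GpY i (parSymY i)) hU hUi le_rfl hR'0.le hDQ hDQs hcb hcb0 hcl hcl0 hCQsr0 hCQsr
    hCQc0 hCQc ℓ' ℓB hℓQ hℓQs hfib hρX0 hGp' hXi hμ h2μ

/-- ★★★ **… AT THE RECORD's COORDINATES** (matrix units, `cb = cl = 1` by `B13MatrixUnitBasisNumerals`): no basis binder left.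
[cite: Balaban1985BackgroundPropagators, (3.24)–(3.25) pp.394–395, (3.35) p.396, Thm 3.1 (3.42) p.397, Thm 3.2 (3.48) p.398, (3.66)–(3.68) p.403, (3.69)–(3.70) p.404, (3.71)–(3.72) p.405, Thm 3.10 (3.107)–(3.108) p.416;
Balaban1988RG2Cluster, (2.5)–(2.7) pp.12–13, p.15] -/
theorem rawEntryLetters_toMatrix_RY_parSymY_prodCfg_of_reg335_record
    (hG : G ≤ B7Prop2Explicit.unitaryUnits (Matrix (Fin N) (Fin N) ℂ))
    {U₀ : CfgY (Matrix (Fin N) (Fin N) ℂ) i} {c α₀ : ℝ} (hC0 : 0 ≤ c * (kGeo i).M * α₀) (hC1 : c * (kGeo i).M * α₀ * ((d : ℝ) + 1) ≤ 1 / 16)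
    (hreg : (bg9K (Matrix (Fin N) (Fin N) ℂ) G i).Reg335 c α₀ U₀)
    (η : ℝ) {Rc : ℝ} (hRc : 0 < Rc) {D : ℕ}
    (hD : ∀ z w, avgCoeffY i z w ≠ 0 →
      Site.tdist ((boxEquiv i.hN).symm z) ((boxEquiv i.hN).symm (cornerY i (levY i z) z)) +
        Site.tdist ((boxEquiv i.hN).symm (cornerY i (levY i z) z)) ((boxEquiv i.hN).symm w) ≤ D)
    {Cavg : ℝ} (hCavg0 : 0 ≤ Cavg) (hCavg : ∀ z, ∑ w, |avgCoeffY i z w| ≤ Cavg)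
    (ℓ' : SiteY i → UT Nf) {s : ℝ} (hs0 : 0 ≤ s)
    (hℓ : ∀ μ z, tdist1 Nf (ℓ' (shiftY i μ z)) (ℓ' z) ≤ s) (hℓa : ∀ z w, avgCoeffY i z w ≠ 0 → tdist1 Nf (ℓ' z) (ℓ' w) ≤ s)
    {κr : ℝ} (hκ0 : 0 ≤ κr)
    (hκ : ∀ z w : SiteY i, κr * tdist1 Nf (ℓ' z) (ℓ' w) ≤ ((((ℓ + 1) ^ i.k : ℕ) : ℝ))⁻¹ * torusSupNorm (toKT i).NB (z.1 - w.1))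
    {m : ℕ} (hfib : ∀ y : UT Nf, (univ.filter fun p : SiteY i × (Fin N × Fin N) => ℓ' p.1 = y).card ≤ m)
    {ρ' : ℝ} (hρ'0 : 0 ≤ ρ') (hρ' : ρ' < (1 / (4 * ((d : ℝ) + 2))) * κr)
    {R' : ℝ} (hR'0 : 0 < R')
    (hR' : R' ≤ Rc / (4 * ((1 * (((d : ℝ) + 1) *
          (1 * Real.exp (|η| * Rc) * (1 * Real.exp (|η| * Rc) * 1 * (1 * Real.exp (|η| * Rc)) + 1) * (1 * Real.exp (|η| * Rc)) +
            (1 * Real.exp (|η| * Rc) * 1 * (1 * Real.exp (|η| * Rc)) + 1)) +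
          Cavg * ((1 * Real.exp (|η| * Rc)) ^ D * 1 * (1 * Real.exp (|η| * Rc)) ^ D)) * Real.exp ((1 / (4 * ((d : ℝ) + 2)) * κr) * s)) *
          (1 * 1 * (16 * ((((ℓ + 1) ^ i.k : ℕ) : ℝ)) ^ 2 * Real.sqrt N)) *
          (m * B6.c0 1 (((1 / (4 * ((d : ℝ) + 2))) * κr - ρ') / 3) ^ ν) * (m * B6.c0 1 (((1 / (4 * ((d : ℝ) + 2))) * κr - ρ') / 3) ^ ν)) + 1))
    {DQ : ℕ}
    (hDQ : ∀ s z, qpK i s z ≠ 0 → Site.tdist ((boxEquiv i.hN).symm (blkCornerY i s)) ((boxEquiv i.hN).symm z) ≤ DQ)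
    (hDQs : ∀ z s, qpsK i z s ≠ 0 → Site.tdist ((boxEquiv i.hN).symm (blkCornerY i s)) ((boxEquiv i.hN).symm z) ≤ DQ)
    {CQsr CQc : ℝ} (hCQsr0 : 0 ≤ CQsr) (hCQsr : ∀ z, ∑ s, |qpsK i z s| ≤ CQsr) (hCQc0 : 0 ≤ CQc) (hCQc : ∀ z, ∑ s, |qpK i s z| ≤ CQc)
    (ℓB : BlkY i → UT Nf) {r : ℝ}
    (hℓQ : ∀ s z, qpK i s z ≠ 0 → tdist1 Nf (ℓB s) (ℓ' z) ≤ r) (hℓQs : ∀ z s, qpsK i z s ≠ 0 → tdist1 Nf (ℓ' z) (ℓB s) ≤ r)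
    {ρX BX μ : ℝ} (hρX0 : 0 ≤ ρX) (hρX : ρX ≤ ρ')
    (hXi : RawEntryLetters (fun a : Fin (d + 1) → Site (PV d ℓ i.m i.K hd hL) 0 → Matrix (Fin N) (Fin N) ℂ =>
      LinearMap.toMatrix
        ((Pi.basis fun _ : BlkY i => Matrix.stdBasis ℂ (Fin N) (Fin N)).reindex (Equiv.sigmaEquivProd (BlkY i) (Fin N × Fin N)))
        ((Pi.basis fun _ : BlkY i => Matrix.stdBasis ℂ (Fin N) (Fin N)).reindex (Equiv.sigmaEquivProd (BlkY i) (Fin N × Fin N)))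
        (XinvY i (parSymY i) (GpY i (parSymY i)) (prodCfg U₀ η a)))
      (fun p : BlkY i × (Fin N × Fin N) => ℓB p.1) R' ρX BX)
    (hμ : 0 < μ) (h2μ : 2 * μ ≤ ρX) :
    RawEntryLetters (fun a : Fin (d + 1) → Site (PV d ℓ i.m i.K hd hL) 0 → Matrix (Fin N) (Fin N) ℂ =>
        LinearMap.toMatrix
          ((Pi.basis fun _ : SiteY i => Matrix.stdBasis ℂ (Fin N) (Fin N)).reindex (Equiv.sigmaEquivProd (SiteY i) (Fin N × Fin N)))
          ((Pi.basis fun _ : SiteY i => Matrix.stdBasis ℂ (Fin N) (Fin N)).reindex (Equiv.sigmaEquivProd (SiteY i) (Fin N × Fin N)))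
          (RY i (parSymY i) (GpY i (parSymY i)) (prodCfg U₀ η a)))
      (fun q : SiteY i × (Fin N × Fin N) => ℓ' q.1) R' (ρX - 2 * μ)
      (1 + 2 * (1 * 1 * (16 * ((((ℓ + 1) ^ i.k : ℕ) : ℝ)) ^ 2 * Real.sqrt N)) *
          (CQsr * (Fintype.card (Fin N × Fin N) : ℝ) * (1 * ((1 * Real.exp (|η| * R')) ^ DQ * 1 * (1 * Real.exp (|η| * R')) ^ DQ)) *
            (CQc * (Fintype.card (Fin N × Fin N) : ℝ) * (1 * ((1 * Real.exp (|η| * R')) ^ DQ * 1 * (1 * Real.exp (|η| * R')) ^ DQ))) * BX *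
            Real.exp (2 * ρX * r) * (2 * (1 * 1 * (16 * ((((ℓ + 1) ^ i.k : ℕ) : ℝ)) ^ 2 * Real.sqrt N))) * (m * B6.c0 1 μ ^ ν)) *
          (m * B6.c0 1 μ ^ ν)) :=
  rawEntryLetters_toMatrix_RY_parSymY_prodCfg_of_reg335 i (Matrix.stdBasis ℂ (Fin N) (Fin N)) hG hC0 hC1 hreg η hRc hD hCavg0 hCavg
    norm_stdBasis_repr_le zero_le_one norm_stdBasis_le_one zero_le_one ℓ' hs0 hℓ hℓa hκ0 hκ hfib hρ'0 hρ' hR'0 hR' hDQ hDQs hCQsr0 hCQsr hCQc0 hCQc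
    ℓB hℓQ hℓQs hρX0 hρX hXi hμ h2μ

end Reg335

end Literature.MathematicalPhysics.QuantumFieldTheory.Balaban1983to89.B13OpsYPencilRProjSym

end
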